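/-
Origin: expansion seat `planner-pub-hodgecm-prl1-0`, handover v6 2026-08-18T03:43:18Z (`HOME/pub-hodgecm-prl1/lean/Prl1/RealisationConstruction.lean`, md5 efe9b6f5, 350 lines);
landed by the gen-5 packager in gate run 19 REPLACES the run-18 copy of `HodgeCM/Proofs/RealisationConstruction.lean` (import ^import Prl1\.ThetaFacts\b→import Prl1.ThetaFacts ×1; run-18 rename map ×2).
-/
/-
Origin: HOME/pub-hodgecm-prl1/lean/Prl1/RealisationConstruction.lean — session planner-pub-hodgecm-prl1-0 (unit
pub-hodgecm-prl1, expansion prover a-1: CONSTRUCT the realisation).  Intended final place: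
`HodgeCM/Proofs/RealisationConstruction.lean` (imports `…ThetaFacts`, `…SignPattern`).
Origin: expansion seat `planner-pub-hodgecm-prl1-0` (unit pub-hodgecm-prl1), handover v1 2026-08-18T03:12:21Z (`HOME/pub-hodgecm-prl1/lean/Prl1/RealisationConstruction.lean`, md5 1a567f7a);
landed by the gen-5 packager as `HodgeCM/Proofs/RealisationConstruction.lean` (module renamed `Prl1.RealisationConstruction` → `HodgeCM.Proofs.RealisationConstruction`, `import Prl1.*` lines renamed accordingly; body otherwise verbatim).
-/
import Summits.HodgeConjecture.HodgeCM.Automorphic.ThetaFacts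
import Summits.HodgeConjecture.HodgeCM.Proofs.SignPattern
import Summits.HodgeConjecture.HodgeCM.Proofs.Prop22.Basic

set_option autoImplicit false

/-!
# Construction of the theta realisation (PerL v5 Def 3.2 – Thm 4.4) from the theta model

From a theta model `T : U.ThetaModel` with its inputs `A : T.Inputs` (run 18: record `ThetaModel.Axioms` renamed `Inputs`, `Fact_theta…/chars/occ` → `Open_…`, `Design_kappaConj/frameSignConj` → `Design_…`; statements unchanged) (`HodgeCM.Automorphic.ThetaFacts`), the geometric model axioms
`M : U.ModelAxioms`, the Hodge–Riemann fact `U.Fact_hodgeRiemann20`, the directedness of levels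
`HodgeCM.LevelDirected` and the Landherr classification target `HodgeCM.Lemma33bLandherr` we CONSTRUCT, for every
seesaw context satisfying PerL's hypotheses, the structure `U.ThetaRealisation ι₁ V K Ψ σ`
(`nonempty_thetaRealisation`), and deduce both open realisation inputs of `HodgeCM.StubTree.Inputs`:

* `realisationExistsPerL_of : … → U.RealisationExistsPerL` (PerL setting: `pairSum_of_isPerLTypes`,
  `injective_of_isPerLTypes`, `t_1 = +`);
* `realisationExistsFace_of : … → U.RealisationExistsFace` (rfwf setting: `pairSum_psi`, `psi_injective`,
  `admissible_mem_psi`).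

What is PROVED here (no hypothesis beyond the ones named): Def 3.2's four lines WITH THE FORCED SIGNS exist
(`exists_signsForced`: weak approximation `HodgeCM.exists_isReal_signs` for `a₀, a₁, a₂` and the trick
`a₃ := a₀a₁a₂⁻¹`, which makes `disc(W₁ ⊕ W₂) = disc(W₃ ⊕ W₄)` an identity and replaces PerL's Hasse-norm step,
tex ll. 304–314); Lemma 3.3(b) (equal signatures at every real place, from the pair-sum identity:
`reqPos_pairSum`); hence the isometry `W₁ ⊕ W₂ ≅ W₃ ⊕ W₄` by `Lemma33bLandherr` (`exists_seesawDatum`); the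
isolation setting with `H_chars`, `H_occ` (Thm 3.7's hypotheses) assembled from the model's packages; the wedge
`Λ = emb ∘ ∪`; `lineField` from Prop 4.3 on FORMS (`Open_thetaWedge`) via Hodge–Riemann (a nonzero holomorphic
2-form has nonzero Petersson norm: `emb_ne_zero`); `Λ_cover` from `Fact_pull_cup` complexified (`pullC_cup2C`) and
level independence; `inner_Λ` from Petersson = cup pairing and `conj (a ∪ b) = ā ∪ b̄` (`conj_cup2C`).
-/

noncomputable section

open scoped TensorProduct InnerProductSpace Matrix

open NumberField NumberField.InfinitePlace

namespace HodgeCM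

open Literature.AlgebraicGeometry.Motives (CMType HodgeStructure)
open Literature.AlgebraicGeometry.Motives.HodgeStructure (conj)
open Literature.AlgebraicGeometry.ShimuraVarieties (conjRingHomK embedding_conjRingHomK)
open HodgeCM.Prior.Perl34File
open CMTypeOps

/-! ### Sign bookkeeping (PerL Lemma 3.3) -/

variable {K : Type} [Field K] in
/-- `1_Φ(φ̄) = 1 − 1_Φ(φ)` (the CM-type axiom). -/
theorem ind_conjugate (Φ : CMType K) (φ : K →+* ℂ) :
    ind Φ (ComplexEmbedding.conjugate φ) = 1 - ind Φ φ := by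
  by_cases h : φ ∈ Φ.1
  · rw [ind_of_mem h, ind_of_not_mem ((mem_iff_conjugate_notMem Φ φ).mp h)]; norm_num
  · rw [ind_of_not_mem h, ind_of_mem ((conjugate_mem_iff_notMem Φ φ).mpr h)]; norm_num

/-- Sign of `x y / z` for nonzero reals. -/
theorem pos_mul_div_iff {x y z : ℝ} (hx : x ≠ 0) (hy : y ≠ 0) (hz : z ≠ 0) :
    (0 < x * y / z) ↔ ((0 < x) ↔ ((0 < y) ↔ (0 < z))) := by
  rw [div_pos_iff, mul_pos_iff, mul_neg_iff]
  rcases hx.lt_or_gt with hx | hx <;> rcases hy.lt_or_gt with hy | hy <;> rcases hz.lt_or_gt with hz | hz <;>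
    simp [hx, hx.not_gt, hy, hy.not_gt, hz, hz.not_gt]

/-- `decide p = b` from `p ↔ b = true`. -/
theorem decide_eq_of_iff' {p : Prop} [Decidable p] {b : Bool} (h : p ↔ b = true) : decide p = b := by
  cases b
  · simpa using h
  · simpa using h

namespace Universe

namespace ThetaModel

variable {U : Universe} (T : U.ThetaModel)

/-- The required sign is a function of the PLACE: `reqPos (τ̄) = reqPos τ`. -/
theorem reqPos_conjugate (hκ : T.Design_kappaConj) (hs : T.Design_frameSignConj) (K L : CMField) (j : K →+* L)
    (ι₁ : L →+* ℂ) (Ψ : CMType K) (τ : L →+* ℂ) :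
    T.reqPos K L j ι₁ Ψ (ComplexEmbedding.conjugate τ) = T.reqPos K L j ι₁ Ψ τ := by
  unfold ThetaModel.reqPos
  rw [hκ, hs, ind_conjugate]
  rcases ind_eq Ψ (T.kappa K L j ι₁ τ) with h | h <;> rw [h] <;> cases T.frameSign L ι₁ τ <;> simp

/-- **Lemma 3.3(b)** (PerL tex ll. 280–298) for the required signs: the pair-sum identity gives equal sign
multisets `{s(W₁), s(W₂)} = {s(W₃), s(W₄)}` at every complex embedding, and determines `s(W₄)` from the other
three (the parity form used for `a₃ := a₀a₁a₂⁻¹`). -/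
theorem reqPos_pairSum {K L : CMField} (j : K →+* L) (ι₁ : L →+* ℂ) (Ψ : Fin 4 → CMType K)
    (hΨ : PairSum Ψ) (τ : L →+* ℂ) :
    (({T.reqPos K L j ι₁ (Ψ 0) τ, T.reqPos K L j ι₁ (Ψ 1) τ} : Multiset Bool) =
        {T.reqPos K L j ι₁ (Ψ 2) τ, T.reqPos K L j ι₁ (Ψ 3) τ}) ∧
      (((T.reqPos K L j ι₁ (Ψ 0) τ = true) ↔
          ((T.reqPos K L j ι₁ (Ψ 1) τ = true) ↔ (T.reqPos K L j ι₁ (Ψ 2) τ = true))) ↔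
        (T.reqPos K L j ι₁ (Ψ 3) τ = true)) := by
  unfold ThetaModel.reqPos
  have h := hΨ (T.kappa K L j ι₁ τ)
  rcases ind_eq (Ψ 0) (T.kappa K L j ι₁ τ) with h0 | h0 <;>
    rcases ind_eq (Ψ 1) (T.kappa K L j ι₁ τ) with h1 | h1 <;>
    rcases ind_eq (Ψ 2) (T.kappa K L j ι₁ τ) with h2 | h2 <;>
    rcases ind_eq (Ψ 3) (T.kappa K L j ι₁ τ) with h3 | h3 <;>
    rw [h0, h1, h2, h3] at h ⊢ <;> norm_num at h <;>
    cases T.frameSign L ι₁ τ <;> simp <;> exact Multiset.cons_swap _ _ _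

/-- `ι b = r ≠ 0` forces `b ≠ 0`. -/
theorem ne_zero_of_embedding {L : CMField} (ι : L →+* ℂ) {b : L} {r : ℝ} (h : ι b = r) (hr : r ≠ 0) :
    b ≠ 0 := by
  rintro rfl
  rw [map_zero] at h
  exact hr (by exact_mod_cast h.symm)

/-- **Def 3.2 with the forced signs** (PerL tex ll. 299–314), CONSTRUCTED: four conjugation-fixed nonzero
`a_i ∈ L` with the required signs and `a₀a₁ = a₂a₃` (so the two planes have the same discriminant on the nose:
`a₃ := a₀a₁a₂⁻¹` has the required sign automatically, by the parity half of `reqPos_pairSum`). -/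
theorem exists_signsForced (hκ : T.Design_kappaConj) (hs : T.Design_frameSignConj) {K L : CMField} (j : K →+* L)
    (ι₁ : L →+* ℂ) (Ψ : Fin 4 → CMType K) (hΨ : PairSum Ψ) :
    ∃ a : Fin 4 → L, (∀ i, conjRingHomK L (a i) = a i) ∧ (∀ i, a i ≠ 0) ∧ a 0 * a 1 = a 2 * a 3 ∧
      ∀ (i : Fin 4) (τ : L →+* ℂ), (0 < (τ (a i)).re ↔ T.reqPos K L j ι₁ (Ψ i) τ = true) := by
  -- the required sign is a function of the place
  let P : Fin 4 → InfinitePlace L → Bool := fun i w => T.reqPos K L j ι₁ (Ψ i) w.embedding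
  have hP : ∀ (i : Fin 4) (τ : L →+* ℂ), T.reqPos K L j ι₁ (Ψ i) τ = P i (InfinitePlace.mk τ) := by
    intro i τ
    have hτ : InfinitePlace.mk τ = InfinitePlace.mk (InfinitePlace.mk τ).embedding := by rw [mk_embedding]
    rcases mk_eq_iff.mp hτ with h | h
    · simp only [P]; rw [← h]
    · simp only [P]; rw [← h, reqPos_conjugate T hκ hs]
  -- a₀, a₁, a₂ by weak approximation at the infinite places
  have hb : ∀ i : Fin 4, ∃ b : L, conjRingHomK L b = b ∧ b ≠ 0 ∧
      ∀ τ : L →+* ℂ, ∃ r : ℝ, τ b = r ∧ r ≠ 0 ∧ (0 < r ↔ T.reqPos K L j ι₁ (Ψ i) τ = true) := by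
    intro i
    obtain ⟨b, hb, h⟩ := exists_isReal_signs L (P i)
    obtain ⟨r₁, hr₁, hr₁0, -⟩ := h ι₁
    refine ⟨b, hb, ne_zero_of_embedding ι₁ hr₁ hr₁0, fun τ => ?_⟩
    obtain ⟨r, hr, hr0, hiff⟩ := h τ
    exact ⟨r, hr, hr0, by rw [hP]; exact hiff⟩
  obtain ⟨b0, hb0, hb0ne, h0⟩ := hb 0
  obtain ⟨b1, hb1, hb1ne, h1⟩ := hb 1
  obtain ⟨b2, hb2, hb2ne, h2⟩ := hb 2
  refine ⟨![b0, b1, b2, b0 * b1 * b2⁻¹], ?_, ?_, ?_, ?_⟩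
  · intro i
    fin_cases i
    · exact hb0
    · exact hb1
    · exact hb2
    · show conjRingHomK L (b0 * b1 * b2⁻¹) = b0 * b1 * b2⁻¹
      rw [map_mul, map_mul, map_inv₀, hb0, hb1, hb2]
  · intro i
    fin_cases i
    · exact hb0ne
    · exact hb1ne
    · exact hb2ne
    · show b0 * b1 * b2⁻¹ ≠ 0
      exact mul_ne_zero (mul_ne_zero hb0ne hb1ne) (inv_ne_zero hb2ne)
  · show b0 * b1 = b2 * (b0 * b1 * b2⁻¹)
    field_simp
  · intro i τ
    obtain ⟨r0, e0, hr0, i0⟩ := h0 τ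
    obtain ⟨r1, e1, hr1, i1⟩ := h1 τ
    obtain ⟨r2, e2, hr2, i2⟩ := h2 τ
    fin_cases i
    · show 0 < (τ b0).re ↔ T.reqPos K L j ι₁ (Ψ 0) τ = true
      rw [e0, Complex.ofReal_re]; exact i0
    · show 0 < (τ b1).re ↔ T.reqPos K L j ι₁ (Ψ 1) τ = true
      rw [e1, Complex.ofReal_re]; exact i1
    · show 0 < (τ b2).re ↔ T.reqPos K L j ι₁ (Ψ 2) τ = true
      rw [e2, Complex.ofReal_re]; exact i2
    · show 0 < (τ (b0 * b1 * b2⁻¹)).re ↔ T.reqPos K L j ι₁ (Ψ 3) τ = true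
      have e3 : τ (b0 * b1 * b2⁻¹) = ((r0 * r1 / r2 : ℝ) : ℂ) := by
        rw [map_mul, map_mul, map_inv₀, e0, e1, e2]; push_cast; rw [div_eq_mul_inv]
      rw [e3, Complex.ofReal_re, pos_mul_div_iff hr0 hr1 hr2, i0, i1, i2]
      exact (T.reqPos_pairSum j ι₁ Ψ hΨ τ).2

/-- **Def 3.2 + Lemma 3.3 ⇒ the seesaw datum** (PerL tex ll. 269–338): with the forced signs the planes
`W₁ ⊕ W₂`, `W₃ ⊕ W₄` have the same signature at every real place (`reqPos_pairSum`) and the same discriminant,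
hence are isometric by Landherr (`HodgeCM.Lemma33bLandherr`, the named classification target). -/
theorem exists_seesawDatum (hκ : T.Design_kappaConj) (hs : T.Design_frameSignConj) (hL : Lemma33bLandherr)
    {K L : CMField} (j : K →+* L) (ι₁ : L →+* ℂ) (Ψ : Fin 4 → CMType K) (hΨ : PairSum Ψ) :
    ∃ D : StubTree.SeesawDatum L, T.SignsForced K L j ι₁ Ψ D := by
  obtain ⟨a, ha, hne, hdisc, hsign⟩ := T.exists_signsForced hκ hs j ι₁ Ψ hΨ
  have hmult : ∀ τ : L →+* ℂ,
      ({decide (0 < (τ (a 0)).re), decide (0 < (τ (a 1)).re)} : Multiset Bool) =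
        {decide (0 < (τ (a 2)).re), decide (0 < (τ (a 3)).re)} := by
    intro τ
    rw [decide_eq_of_iff' (hsign 0 τ), decide_eq_of_iff' (hsign 1 τ), decide_eq_of_iff' (hsign 2 τ),
      decide_eq_of_iff' (hsign 3 τ)]
    exact (T.reqPos_pairSum j ι₁ Ψ hΨ τ).1
  obtain ⟨g, hg⟩ := hL L a ha hne hmult ⟨1, one_ne_zero, by rw [map_one, mul_one, mul_one, hdisc]⟩
  exact ⟨⟨a, ha, hne, ⟨g, hg⟩⟩, fun i τ => hsign i τ⟩

end ThetaModel

/-! ### Geometric lemmas over the Universe -/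

variable {U : Universe}

/-- `conj (a ∪ b) = ā ∪ b̄` for the complexified cup product (`conj = conj ⊗ id`, `cup2C = ℂ ⊗ cup`). -/
theorem conj_cup2C (X : U.Var) (k : ℕ) (a b : U.CohC X k) :
    conj (U.cup2C X k a b) = U.cup2C X k (conj a) (conj b) := by
  induction a using TensorProduct.induction_on with
  | zero => simp
  | tmul c x =>
    induction b using TensorProduct.induction_on with
    | zero => simp
    | tmul d y =>
      simp only [Universe.cup2C, LinearMap.BilinMap.baseChange_tmul, HodgeStructure.conj_tmul, map_mul]
    | add b₁ b₂ h₁ h₂ => simp only [map_add, h₁, h₂]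
  | add a₁ a₂ h₁ h₂ => simp only [map_add, LinearMap.add_apply, h₁, h₂]

/-- `H^{1,0} ⊆ F¹H¹`. -/
theorem H10_le_F1 (X : U.Var) : U.H10 X ≤ (U.hodge X 1).F 1 := fun _ hx =>
  ((HodgeStructure.mem_piece_iff _ (by norm_num)).mp hx).1

/-- The cup of two `(1,0)`-classes lies in `F²H²` (`Fact_cup2_hodge`). -/
theorem cup2C_mem_F2 (M : U.ModelAxioms) (X : U.Var) {a b : U.CohC X 1} (ha : a ∈ U.H10 X)
    (hb : b ∈ U.H10 X) : U.cup2C X 1 a b ∈ (U.hodge X 2).F 2 :=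
  M.cup2_hodge X 1 1 1 a b (H10_le_F1 X ha) (H10_le_F1 X hb)

namespace ThetaModel

variable (T : U.ThetaModel)

/-- A nonzero holomorphic 2-form has a nonzero `L²` function: Petersson = cup pairing (`Fact_innerEmb`) and
Hodge–Riemann (`Fact_hodgeRiemann20`, `PmsDimTwo`). -/
theorem emb_ne_zero (M : U.ModelAxioms) (hI : T.Fact_innerEmb) (hHR : U.Fact_hodgeRiemann20)
    {L : CMField} {ι₁ : L →+* ℂ} {V : HermSpace3 L ι₁} (Γ : Level V) {η : U.CohC (U.pms L ι₁ V Γ) 2}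
    (hη : η ∈ (U.hodge (U.pms L ι₁ V Γ) 2).F 2) (hne : η ≠ 0) : T.emb Γ η ≠ 0 := by
  obtain ⟨c, hc, h⟩ := hI Γ
  intro h0
  have h1 := h η η hη hη
  rw [h0, inner_zero_left] at h1
  rcases mul_eq_zero.mp h1.symm with h2 | h2
  · exact hc h2
  · exact hHR _ (M.pms_dim L ι₁ V Γ) η hη hne h2

/-- **The construction from a GIVEN forced-sign seesaw datum, inputs unbundled** — the one proof body of the
file (PerL v5 Def 3.2 – §4 assembled).  Hypotheses: the model facts, the inputs of `ThetaModel.Inputs` other than the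
two sign constraints and A6, `Fact_hodgeRiemann20`, `LevelDirected`, the context data, a seesaw datum `D` with the
forced signs (`SignsForced`; supplied from `Lemma33bLandherr` by `exists_seesawDatum`, or WITHOUT any local–global
input by `HodgeCM.Proofs.SeesawConstruction.exists_seesawDatum_constructed`, seat landherr-g2, run 19), and A6 only
AT THE GIVEN `(L, ι₁, V)` as the last hypothesis `h₆`.  Every other construction theorem of the package is a
specialisation of this one. -/
theorem nonempty_thetaRealisation_ofD (M : U.ModelAxioms) (h₁ : T.Fact_embCover) (h₂ : T.Fact_innerEmb)
    (h₅ : T.Open_thetaSub) (h₇ : T.Open_thetaGen12) (h₈ : T.Open_thetaReal34) (h₉ : T.Open_chars)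
    (h₁₀ : T.Open_occ) (hHR : U.Fact_hodgeRiemann20) (hLD : LevelDirected) {K L : CMField} (j : K →+* L)
    (ι₁ : L →+* ℂ) (Ψ : Fin 4 → CMType K) (σ : K →+* ℂ) (hσ : ι₁.comp j = σ) (hΨ : PairSum Ψ)
    (hinj : Function.Injective Ψ) (hmem : ∀ i, σ ∈ (Ψ i).1) (V : HermSpace3 L ι₁)
    (D : StubTree.SeesawDatum L) (hD : T.SignsForced K L j ι₁ Ψ D)
    (h₆ : ∀ c : SeesawCtx L, T.GoodCtx ι₁ c →
      ∃ Γ : Level V, ∃ ω₁ ∈ T.Theta V c 0 Γ, ∃ ω₂ ∈ T.Theta V c 1 Γ, U.cup2C (U.pms L ι₁ V Γ) 1 ω₁ ω₂ ≠ 0) :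
    Nonempty (U.ThetaRealisation ι₁ V K Ψ σ) := by
  let c : SeesawCtx L := ⟨K, Ψ, σ, D⟩
  have hc : T.GoodCtx ι₁ c := ⟨hΨ, hinj, hmem, ⟨j, hσ, hD⟩⟩
  have hH10 : ∀ (i : Fin 4) (Γ : Level V), ∀ ω ∈ T.Theta V c i Γ, ω ∈ U.H10 (U.pms L ι₁ V Γ) :=
    fun i Γ ω hω => U.Uiso_le_H10 M.pull_hodge Γ K (Ψ i) σ (h₅ V c hc i Γ hω)
  refine ⟨{
    H := T.H V c
    HG := T.HG L ι₁ V
    CG := T.CG V c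
    G := T.G V c
    SK := T.SK V c
    SigIdx := T.SigIdx V c
    SigIdxG := T.SigIdxG V c
    S := { core := T.core V c, t12 := T.t12 V c, t34 := T.t34 V c
           H_chars12 := (h₉ V c hc).1, H_chars34 := (h₉ V c hc).2
           H_occ12 := (h₁₀ V c hc).1, H_occ34 := (h₁₀ V c hc).2 }
    Λ := fun Γ => T.Λ Γ
    Theta := fun i Γ => T.Theta V c i Γ
    Theta_sub := fun i Γ => h₅ V c hc i Γ
    lineField := ?_
    gen12 := fun Γ ω₁ ω₂ e₁ e₂ => h₇ V c hc Γ ω₁ ω₂ e₁ e₂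
    real34 := fun χ hχ Φ => h₈ V c hc χ hχ Φ
    cover := fun Γ Γ' h => T.cover Γ Γ' h
    Λ_cover := ?_
    level_inf := hLD L ι₁ V
    inner_Λ := ?_ }⟩
  · -- Prop 4.3 on forms ⇒ on L² functions (Hodge–Riemann)
    obtain ⟨Γ, ω₁, e₁, ω₂, e₂, hne⟩ := h₆ c hc
    exact ⟨Γ, ω₁, e₁, ω₂, e₂,
      T.emb_ne_zero M h₂ hHR Γ (cup2C_mem_F2 M _ (hH10 0 Γ ω₁ e₁) (hH10 1 Γ ω₂ e₂)) hne⟩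
  · -- level independence of the wedge-function
    intro Γ Γ' h ω ω'
    show T.emb Γ' (U.cup2C _ 1 (U.pullC (T.cover Γ Γ' h) 1 ω) (U.pullC (T.cover Γ Γ' h) 1 ω')) =
      T.emb Γ (U.cup2C _ 1 ω ω')
    rw [← pullC_cup2C M.pull_cup]
    exact h₁ Γ Γ' h _
  · -- Petersson = period
    intro Γ
    obtain ⟨c₀, hc₀, h⟩ := h₂ Γ
    refine ⟨c₀, hc₀, fun ω hω => ?_⟩
    show ⟪T.emb Γ (U.cup2C _ 1 (ω 2) (ω 3)), T.emb Γ (U.cup2C _ 1 (ω 0) (ω 1))⟫_ℂ = c₀ * U.period _ ω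
    rw [h _ _ (cup2C_mem_F2 M _ (hω 0) (hω 1)) (cup2C_mem_F2 M _ (hω 2) (hω 3)), conj_cup2C _ 1]
    rfl

/-- **The construction, inputs unbundled** (PerL v5 Def 3.2 – §4 assembled; = `nonempty_thetaRealisation_ofD` with
the seesaw datum taken from `Lemma33bLandherr`): as `nonempty_thetaRealisation`,
with the ten inputs of `ThetaModel.Inputs` as separate hypotheses and A6 (Prop 4.3, `Open_thetaWedge`) only AT THE
GIVEN `(L, ι₁, V)`, as the last hypothesis `h₆` — the form consumed by the refinements that DERIVE Prop 4.3 from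
finer inputs (`HodgeCM.Automorphic.ThetaWedgeSplit`: the ball route; `HodgeCM.Automorphic.HeckeWedge`: Venkataramana's
theorem, which needs `[L:ℚ] ≥ 4`). -/
theorem nonempty_thetaRealisation_of (M : U.ModelAxioms) (h₁ : T.Fact_embCover) (h₂ : T.Fact_innerEmb)
    (h₃ : T.Design_kappaConj) (h₄ : T.Design_frameSignConj) (h₅ : T.Open_thetaSub) (h₇ : T.Open_thetaGen12)
    (h₈ : T.Open_thetaReal34) (h₉ : T.Open_chars) (h₁₀ : T.Open_occ) (hHR : U.Fact_hodgeRiemann20)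
    (hLD : LevelDirected) (hL : Lemma33bLandherr) {K L : CMField} (j : K →+* L) (ι₁ : L →+* ℂ)
    (Ψ : Fin 4 → CMType K) (σ : K →+* ℂ) (hσ : ι₁.comp j = σ) (hΨ : PairSum Ψ)
    (hinj : Function.Injective Ψ) (hmem : ∀ i, σ ∈ (Ψ i).1) (V : HermSpace3 L ι₁)
    (h₆ : ∀ c : SeesawCtx L, T.GoodCtx ι₁ c →
      ∃ Γ : Level V, ∃ ω₁ ∈ T.Theta V c 0 Γ, ∃ ω₂ ∈ T.Theta V c 1 Γ, U.cup2C (U.pms L ι₁ V Γ) 1 ω₁ ω₂ ≠ 0) :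
    Nonempty (U.ThetaRealisation ι₁ V K Ψ σ) := by
  obtain ⟨D, hD⟩ := T.exists_seesawDatum h₃ h₄ hL j ι₁ Ψ hΨ
  exact T.nonempty_thetaRealisation_ofD M h₁ h₂ h₅ h₇ h₈ h₉ h₁₀ hHR hLD j ι₁ Ψ σ hσ hΨ hinj hmem V D hD h₆

/-- **The construction** (PerL v5 Def 3.2 – §4 assembled): in a seesaw context satisfying PerL's hypotheses the
theta realisation data exist. -/
theorem nonempty_thetaRealisation (M : U.ModelAxioms) (A : T.Inputs) (hHR : U.Fact_hodgeRiemann20)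
    (hLD : LevelDirected) (hL : Lemma33bLandherr) {K L : CMField} (j : K →+* L) (ι₁ : L →+* ℂ)
    (Ψ : Fin 4 → CMType K) (σ : K →+* ℂ) (hσ : ι₁.comp j = σ) (hΨ : PairSum Ψ)
    (hinj : Function.Injective Ψ) (hmem : ∀ i, σ ∈ (Ψ i).1) (V : HermSpace3 L ι₁) :
    Nonempty (U.ThetaRealisation ι₁ V K Ψ σ) :=
  T.nonempty_thetaRealisation_of M A.embCover A.innerEmb A.kappaConj A.frameSignConj A.thetaSub A.thetaGen12
    A.thetaReal34 A.chars A.occ hHR hLD hL j ι₁ Ψ σ hσ hΨ hinj hmem V fun c hc => A.thetaWedge V c hc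

/-- **PerL setting.** `RealisationExistsPerL` from the theta model: the sextic types satisfy the pair-sum identity
(`StubTree.pairSum_of_isPerLTypes`), are pairwise distinct (`StubTree.injective_of_isPerLTypes`) and all contain
`φ₁ = ι₁|_K` (`t_1 = +`). -/
theorem realisationExistsPerL_of (M : U.ModelAxioms) (A : T.Inputs) (hHR : U.Fact_hodgeRiemann20)
    (hLD : LevelDirected) (hL : Lemma33bLandherr) : U.RealisationExistsPerL := by
  intro K L j _ hK _ φ hφ ι₁ hι₁ t ht V
  have hmem : ∀ i, φ 0 ∈ (t i).1 := fun i => (ht i 0).mpr (by fin_cases i <;> rfl)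
  exact T.nonempty_thetaRealisation M A hHR hLD hL j ι₁ t (φ 0) hι₁
    (StubTree.pairSum_of_isPerLTypes K φ hφ hK t ht) (StubTree.injective_of_isPerLTypes K φ hφ t ht) hmem V

/-- **Face setting (rfwf Thm 4.1 data).** `RealisationExistsFace` from the theta model: `K = L = F`, `j = id`,
types `f.psi` (`pairSum_psi`, `StubTree.psi_injective`), `σ = ι₁ ∈ ψ_i` (`admissible_mem_psi`). -/
theorem realisationExistsFace_of (M : U.ModelAxioms) (A : T.Inputs) (hHR : U.Fact_hodgeRiemann20)
    (hLD : LevelDirected) (hL : Lemma33bLandherr) : U.RealisationExistsFace := by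
  intro F _ _ f ι₁ hadm V
  exact T.nonempty_thetaRealisation M A hHR hLD hL (RingHom.id F) ι₁ f.psi ι₁ (RingHom.comp_id ι₁)
    (pairSum_psi f) (StubTree.psi_injective F f) (admissible_mem_psi f ι₁ hadm) V

/-- Both realisation inputs of `HodgeCM.Universe.OpenInputs` at once. -/
theorem realisationExists_of (M : U.ModelAxioms) (A : T.Inputs) (hHR : U.Fact_hodgeRiemann20)
    (hLD : LevelDirected) (hL : Lemma33bLandherr) :
    U.RealisationExistsPerL ∧ U.RealisationExistsFace :=
  ⟨T.realisationExistsPerL_of M A hHR hLD hL, T.realisationExistsFace_of M A hHR hLD hL⟩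

end ThetaModel

end Universe

end HodgeCM

end
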